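import Summits.QuantumFields.YangMills.Theorems.UnitScaleTiltProp7LineAvgRightInverse
import HarnessLib

/-!
# Route `UnitScaleTilt`, crux K1 child «MinimiserStabilityRegPr» (stmt-QuantumFields-19200), registered stub `stub_prop7From14` (leaf V3 «Prop 7 from a
# background (14)») — MULTIPLIER DUALITY: a right inverse of the linearised averaging bounded `ℓ¹ → ℓ¹` gives (i) the EXISTENCE of the Lagrange multiplier
# for every current annihilating the kernel and (ii) the SUP BOUND `max|μ| ≤ B·max|J|` for every adjoint pair `⟨J, Y⟩ = ⟨μ, TY⟩`

Cell `ym3-torus` ∕ fleet seat `ym-ust-19200-p1` (gen 4).  WHERE THIS SITS.  In the `ℓ²` route to the uniqueness clause of [Balaban1985Variational] Prop. 7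
(p504929) the first-order term of the action at an R2-critical configuration is handled through the Euler–Lagrange equation in multiplier form, `J = T^⊤μ`
([Balaban1985Variational] (152) «D*F = Q*λ»; lineage `Prop8Criticality`), and the multiplier must be bounded in SUP norm by the current (`max|J| < ε₀L^{−3(K−n)}`
is print's divergence clause of (6)).  `UnitScaleTiltProp7LineAvgAdjoint` (p515186) proved this for the straight-line main term from the explicit tent formula
of `M_k^⊤`.  This file isolates the GENERAL MECHANISM, with no formula for the transpose: if `T` has a right inverse `H` with `Σ_b|HZ(b)| ≤ B·Σ_c|Z(c)|`, then
every adjoint pair `(J, μ)` (`Σ_bJ(b)Y(b) = Σ_cμ(c)(TY)(c)` for all `Y`) has `|μ(c)| ≤ B·max|J|` (test with `Y = H(μ(c)δ_c)`); and if `T` respects differences and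
`H` is linear, every `J` annihilating `ker T` HAS such a `μ` (`μ(c) = ⟨J, Hδ_c⟩`, because `Y − H(TY) ∈ ker T`).  With gen 3's `exists_rightInverse_bondAvgIter`
(`ℓ¹` bound `6L^{kd}`) this re-derives the straight-line multiplier bound; it applies verbatim to the TRUE linearised (0.4) average once an `ℓ¹`-bounded
right inverse of it is in the tree (flat one step: p507678's right inverse; CARD-19200-V3-g4, D1c (ii)).

WHAT IS PROVED HERE (sorry-free, no definition; [folklore] finite-dimensional duality).
* `abs_le_of_adjoint_of_rightInverse_l1` (sup bound), `exists_multiplier_of_annihilates_ker` (existence), and the instance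
  **`exists_multiplier_abs_le_bondAvgIter`** for `T = bondAvgIter k`: every real current `J ⊥ ker Q_k` is `Q_k^⊤μ` for some `μ` with `max|μ| ≤ 6L^{kd}·max|J|`
  (`k` in the standing range); `_T3` at the d = 3 carrier.

References: T. Bałaban, CMP 102 (1985) 277–309 [Balaban1985Variational] ((6) p.278, (45)–(46) p.285, (152) p.300).
-/

noncomputable section

open scoped BigOperators

namespace Summit.QuantumFields.YangMills.Theorems.Prop7MultiplierDuality

open Literature.MathematicalPhysics.QuantumFieldTheory.Balaban1983to89
open Finset LatticeFieldCalculus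
open Summit.QuantumFields.YangMills.Theorems.Prop7LineAvgRightInverse (exists_rightInverse_bondAvgIter)

/-! ## §1 Abstract duality on finite index types -/

section Abstract

variable {β γ : Type*} [Fintype β] [Fintype γ] [DecidableEq γ]

/-- **SUP BOUND OF THE MULTIPLIER BY DUALITY**: if `T(HZ) = Z` with `Σ_b|HZ(b)| ≤ B·Σ_c|Z(c)|` for all `Z`, and `(J, μ)` is an adjoint pair for `T`
(`Σ_bJ(b)Y(b) = Σ_cμ(c)(TY)(c)` for all `Y`), then `|μ(c)| ≤ B·M` whenever `|J| ≤ M` (`M ≥ 0`). [folklore] -/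
theorem abs_le_of_adjoint_of_rightInverse_l1 (T : (β → ℝ) → (γ → ℝ)) (H : (γ → ℝ) → (β → ℝ)) (hTH : ∀ Z, T (H Z) = Z)
    {B : ℝ} (hB : 0 ≤ B) (hH : ∀ Z, ∑ b, |H Z b| ≤ B * ∑ c, |Z c|) (J : β → ℝ) (μ : γ → ℝ)
    (hadj : ∀ Y, ∑ b, J b * Y b = ∑ c, μ c * T Y c) {M : ℝ} (hM : 0 ≤ M) (hJ : ∀ b, |J b| ≤ M) (c : γ) : |μ c| ≤ B * M := by
  -- test field `Z = μ(c)·δ_c`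
  set Z : γ → ℝ := Pi.single c (μ c) with hZ
  have h1 : ∑ c', μ c' * T (H Z) c' = μ c ^ 2 := by
    rw [hTH, Fintype.sum_eq_single c (fun c' hc' => by rw [hZ, Pi.single_eq_of_ne hc', mul_zero]), hZ, Pi.single_eq_same, sq]
  have h2 : ∑ c', |Z c'| = |μ c| := by
    rw [Fintype.sum_eq_single c (fun c' hc' => by rw [hZ, Pi.single_eq_of_ne hc', abs_zero]), hZ, Pi.single_eq_same]
  have h3 : μ c ^ 2 ≤ M * (B * |μ c|) := by
    calc μ c ^ 2 = ∑ c', μ c' * T (H Z) c' := h1.symm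
      _ = ∑ b, J b * H Z b := (hadj (H Z)).symm
      _ ≤ ∑ b, |J b| * |H Z b| := Finset.sum_le_sum fun b _ => by rw [← abs_mul]; exact le_abs_self _
      _ ≤ ∑ b, M * |H Z b| := Finset.sum_le_sum fun b _ => mul_le_mul_of_nonneg_right (hJ b) (abs_nonneg _)
      _ = M * ∑ b, |H Z b| := by rw [Finset.mul_sum]
      _ ≤ M * (B * ∑ c', |Z c'|) := mul_le_mul_of_nonneg_left (hH Z) hM
      _ = M * (B * |μ c|) := by rw [h2]
  nlinarith [sq_abs (μ c), abs_nonneg (μ c), mul_nonneg hB hM, h3]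

/-- **EXISTENCE OF THE MULTIPLIER**: if `T` respects differences, `H` is a LINEAR right inverse of `T`, and the current `J` annihilates `ker T`
(`TY = 0 ⇒ Σ_bJ(b)Y(b) = 0`), then `μ(c) := Σ_b J(b)·(Hδ_c)(b)` is a multiplier: `Σ_bJ(b)Y(b) = Σ_cμ(c)(TY)(c)` for every `Y` (`Y − H(TY) ∈ ker T`). [folklore] -/
theorem exists_multiplier_of_annihilates_ker (T : (β → ℝ) → (γ → ℝ)) (hTsub : ∀ Y Y', T (Y - Y') = T Y - T Y')
    (H : (γ → ℝ) →ₗ[ℝ] (β → ℝ)) (hTH : ∀ Z, T (H Z) = Z) (J : β → ℝ) (hJ : ∀ Y, T Y = 0 → ∑ b, J b * Y b = 0) :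
    ∃ μ : γ → ℝ, ∀ Y, ∑ b, J b * Y b = ∑ c, μ c * T Y c := by
  refine ⟨fun c => ∑ b, J b * H (Pi.single c 1) b, fun Y => ?_⟩
  -- `Y − H(TY) ∈ ker T`
  have hker : T (Y - H (T Y)) = 0 := by rw [hTsub, hTH, sub_self]
  have h0 := hJ _ hker
  have hsplit : ∑ b, J b * Y b = ∑ b, J b * H (T Y) b + ∑ b, J b * (Y - H (T Y)) b := by
    rw [← Finset.sum_add_distrib]
    exact Finset.sum_congr rfl fun b _ => by rw [Pi.sub_apply]; ring
  rw [hsplit, h0, add_zero]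
  -- `H(TY) = Σ_c (TY)(c)·Hδ_c`
  have hTY : T Y = ∑ c, (T Y c) • (Pi.single c (1 : ℝ) : γ → ℝ) := by
    conv_lhs => rw [← Finset.univ_sum_single (T Y)]
    refine Finset.sum_congr rfl fun c _ => ?_
    funext c'
    rw [Pi.smul_apply, smul_eq_mul]
    by_cases hc : c' = c
    · subst hc; rw [Pi.single_eq_same, Pi.single_eq_same, mul_one]
    · rw [Pi.single_eq_of_ne hc, Pi.single_eq_of_ne hc, mul_zero]
  have hH : H (T Y) = ∑ c, (T Y c) • H (Pi.single c 1) := by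
    conv_lhs => rw [hTY]
    rw [map_sum]
    exact Finset.sum_congr rfl fun c _ => by rw [map_smul]
  rw [hH]
  simp only [Finset.sum_apply, Pi.smul_apply, smul_eq_mul, Finset.mul_sum]
  rw [Finset.sum_comm]
  refine Finset.sum_congr rfl fun c _ => ?_
  rw [Finset.sum_mul]
  exact Finset.sum_congr rfl fun b _ => by ring

end Abstract

/-! ## §2 The instance for the straight-line block average of record -/

section BondAvg

variable {P : Params} {k : ℕ}

/-- `bondAvgIter k` respects differences (it is linear; from its explicit form `Prop7FlatCoercivity.bondAvgIter_eq_lineBlockAvg_real`). [folklore] -/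
theorem bondAvgIter_sub (hk : k ≤ P.m + P.K) (Y Y' : VecField P 0 ℝ) :
    bondAvgIter k (Y - Y') = bondAvgIter k Y - bondAvgIter k Y' := by
  funext c
  rw [Pi.sub_apply, Prop7FlatCoercivity.bondAvgIter_eq_lineBlockAvg_real hk, Prop7FlatCoercivity.bondAvgIter_eq_lineBlockAvg_real hk,
    Prop7FlatCoercivity.bondAvgIter_eq_lineBlockAvg_real hk, ← mul_sub, ← Finset.sum_sub_distrib]
  congr 1
  exact Finset.sum_congr rfl fun x _ => by rw [← Finset.sum_sub_distrib]; rfl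

/-- **MULTIPLIER DUALITY FOR `Q_k = bondAvgIter k`** (`k` in the standing range): every real current `J` annihilating `ker Q_k` is `Q_k^⊤μ` for some `μ`,
`Σ_bJ(b)Y(b) = Σ_cμ(c)(Q_kY)(c)`, and EVERY such `μ` obeys `max|μ| ≤ 6L^{kd}·max|J|` (gen 3's right inverse, `ℓ¹` bound `6L^{kd}`).
[cite: Balaban1985Variational, (45)-(46) p.285, (152) p.300] -/
theorem exists_multiplier_abs_le_bondAvgIter (hk : k ≤ P.m + P.K) (J : PBond P 0 → ℝ) (hJ : ∀ Y : VecField P 0 ℝ, bondAvgIter k Y = 0 → ∑ b, J b * Y b = 0) :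
    (∃ μ : PBond P k → ℝ, ∀ Y : VecField P 0 ℝ, ∑ b, J b * Y b = ∑ c, μ c * bondAvgIter k Y c) ∧
    ∀ (μ : PBond P k → ℝ), (∀ Y : VecField P 0 ℝ, ∑ b, J b * Y b = ∑ c, μ c * bondAvgIter k Y c) →
      ∀ M : ℝ, 0 ≤ M → (∀ b, |J b| ≤ M) → ∀ c, |μ c| ≤ 6 * ((P.L : ℝ) ^ k) ^ P.d * M := by
  classical
  obtain ⟨H, hH⟩ := exists_rightInverse_bondAvgIter (P := P) hk
  refine ⟨exists_multiplier_of_annihilates_ker (bondAvgIter k) (bondAvgIter_sub hk) H (fun Z => (hH Z).1) J hJ, fun μ hμ M hM hJM c => ?_⟩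
  exact abs_le_of_adjoint_of_rightInverse_l1 (bondAvgIter k) H (fun Z => (hH Z).1) (by positivity) (fun Z => (hH Z).2.2.1) J μ hμ hM hJM c

/-- **AT THE d = 3 CARRIER** (`k = K − n`): multipliers exist for every current annihilating `ker Q_{K−n}` and obey `max|μ| ≤ 6L^{3(K−n)}·max|J|`; with print's
divergence clause `max|J| < ε₀L^{−3(K−n)}` this is `max|μ| ≤ 6ε₀`. [cite: Balaban1985Variational, (6) p.278, (152) p.300] -/
theorem exists_multiplier_abs_le_bondAvgIter_T3 (F : T3ContinuumYM3Torus.T3Family) (n K : ℕ) (J : PBond (F.P K) 0 → ℝ)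
    (hJ : ∀ Y : VecField (F.P K) 0 ℝ, bondAvgIter (K - n) Y = 0 → ∑ b, J b * Y b = 0) :
    (∃ μ : PBond (F.P K) (K - n) → ℝ, ∀ Y : VecField (F.P K) 0 ℝ, ∑ b, J b * Y b = ∑ c, μ c * bondAvgIter (K - n) Y c) ∧
    ∀ (μ : PBond (F.P K) (K - n) → ℝ), (∀ Y : VecField (F.P K) 0 ℝ, ∑ b, J b * Y b = ∑ c, μ c * bondAvgIter (K - n) Y c) →
      ∀ M : ℝ, 0 ≤ M → (∀ b, |J b| ≤ M) → ∀ c, |μ c| ≤ 6 * ((F.L : ℝ) ^ (K - n)) ^ 3 * M :=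
  exists_multiplier_abs_le_bondAvgIter (P := F.P K) (show K - n ≤ F.m + K by omega) J hJ

end BondAvg

end Summit.QuantumFields.YangMills.Theorems.Prop7MultiplierDuality

end
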